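import Mathlib
import Summits.KontsevichZagierPeriods.Zeta5Search.SecondOrderDigit
import Summits.KontsevichZagierPeriods.Zeta5Search.LemmaDBonusTypes
import HarnessLib

/-!
# ζ(5) search — SECOND-ORDER TYPE FUNCTIONALS `ŵ₂(T)`, `v̂₂(T)`, `τ(T)` of a level class (tools for gen-2 g10's THEOREM A‴)

Cell `pub-zeta5` (HONEST FRAMING: systematic search; no irrationality claim unless certified), typer seat generation 11.
P1 g6's `LevelClass` layer (`typeRho`, `typeW`, `typeV`: the first-digit data of a residue class `{x, x+p, …, x+Lp}` are closed
expressions in its exponent vector `e = (e₀,…,e_L)`) extended to the second-order invariants of `Zeta5Search/SecondOrderDigit.lean`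
(gen-2 g10): `typeW2`/`typeV2` (= `ŵ[ηΦ_T]`, `v̂[ηΦ_T]`), `typeTauW`/`typeTauV` (= `τ(T) = σ[(2η − L)Φ_T]`), with the level lemmas
`wHat2_level₀`, `vHat2_level₀`, `tauW_level₀`, `tauV_level₀`, `topLevel_level`, `classTypeList_level` under the WEAK centre
hypothesis `¬(b₀ odd ∧ centre ∈ class)` (an even centre is merged into `netExp` and carries no cofactor), and the list bookkeeping that
turns the hypotheses of `LawA3` (`classTypeList b p x = T`, `T.reverse = T`, `isRaise T S`) into statements about exponent functions
(`levelData_of_typeList`, `pal_of_reverse`, `isRaise_level`).  Nothing here bears on irrationality.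
-/

noncomputable section

open Finset PowerSeries

namespace Summit.KontsevichZagierPeriods.Zeta5Search.SecondOrder

open Summit.KontsevichZagierPeriods.Zeta5Search.DualSeries (InBox)
open Summit.KontsevichZagierPeriods.Zeta5Search.CasoratianValuation (InPolytope)
open Summit.KontsevichZagierPeriods.Zeta5Search.ClusterValuation
open Summit.KontsevichZagierPeriods.Zeta5Search.PadicSeries
open Summit.KontsevichZagierPeriods.Zeta5Search.LevelClass (typeRho typeW typeV typeExp classSet_level level_injective level_mem
  classPoles_level typeRho_congr typeW_congr typeV_congr)
open Literature.NumberTheory.Transcendental.BallRivoal (harm)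

variable {p : ℕ} [hp : Fact p.Prime]

/-! ## §1 Second-order type functionals -/

/-- `ŵ₂(T) := Σ_{poles i} (i ρ^T_{i,3} [n_i ≥ 3] + ρ^T_{i,4} [n_i ≥ 4])` = `ŵ[ηΦ_T]`. -/
def typeW2 (L : ℕ) (e : ℕ → ℤ) : ℚ :=
  ∑ i ∈ (range (L + 1)).filter (fun i => e i < 0),
    ((if e i ≤ -3 then ((i : ℕ) : ℚ) * typeRho L e i 3 else 0) + (if e i ≤ -4 then typeRho L e i 4 else 0))

/-- `v̂₂(T) := Σ_{poles i} Σ_{σ=1}^{n_i} (−1)^σ (i ρ^T_{i,σ} + ρ^T_{i,σ+1}[σ+1 ≤ n_i]) H^{(σ)}_i` = `v̂[ηΦ_T]`. -/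
def typeV2 (L : ℕ) (e : ℕ → ℤ) : ℚ :=
  ∑ i ∈ (range (L + 1)).filter (fun i => e i < 0), ∑ σ ∈ Icc 1 (-e i).toNat,
    (-1 : ℚ) ^ σ * (((i : ℕ) : ℚ) * typeRho L e i σ + (if (σ : ℤ) + 1 ≤ -e i then typeRho L e i (σ + 1) else 0)) * harm σ i

/-- `τ_W(T) := 2ŵ₂(T) − L ŵ(T)`. -/
def typeTauW (L : ℕ) (e : ℕ → ℤ) : ℚ := 2 * typeW2 L e - (L : ℚ) * typeW L e

/-- `τ_V(T) := 2v̂₂(T) − L v̂(T)`. -/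
def typeTauV (L : ℕ) (e : ℕ → ℤ) : ℚ := 2 * typeV2 L e - (L : ℚ) * typeV L e

omit hp in
/-- `typeW2` only sees `e₀,…,e_L`. -/
theorem typeW2_congr {L : ℕ} {e e' : ℕ → ℤ} (h : ∀ k ≤ L, e k = e' k) : typeW2 L e = typeW2 L e' := by
  unfold typeW2
  rw [filter_congr (fun i hi => by rw [h i (by have := mem_range.1 hi; omega)])]
  refine sum_congr rfl fun i hi => ?_
  have hiL : i ≤ L := by have := mem_range.1 (mem_filter.1 hi).1; omega
  rw [h i hiL, typeRho_congr h hiL, typeRho_congr h hiL]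

omit hp in
/-- `typeV2` only sees `e₀,…,e_L`. -/
theorem typeV2_congr {L : ℕ} {e e' : ℕ → ℤ} (h : ∀ k ≤ L, e k = e' k) : typeV2 L e = typeV2 L e' := by
  unfold typeV2
  rw [filter_congr (fun i hi => by rw [h i (by have := mem_range.1 hi; omega)])]
  refine sum_congr rfl fun i hi => ?_
  have hiL : i ≤ L := by have := mem_range.1 (mem_filter.1 hi).1; omega
  rw [h i hiL]
  refine sum_congr rfl fun σ _ => ?_
  rw [typeRho_congr h hiL, typeRho_congr h hiL]

omit hp in
/-- `typeTauW` only sees `e₀,…,e_L`. -/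
theorem typeTauW_congr {L : ℕ} {e e' : ℕ → ℤ} (h : ∀ k ≤ L, e k = e' k) : typeTauW L e = typeTauW L e' := by
  unfold typeTauW; rw [typeW2_congr h, typeW_congr h]

omit hp in
/-- `typeTauV` only sees `e₀,…,e_L`. -/
theorem typeTauV_congr {L : ℕ} {e e' : ℕ → ℤ} (h : ∀ k ≤ L, e k = e' k) : typeTauV L e = typeTauV L e' := by
  unfold typeTauV; rw [typeV2_congr h, typeV_congr h]

/-! ## §2 Level lemmas under the weak centre hypothesis -/

section Level

variable (b : ℕ → ℤ) {x L : ℕ} (hx : x < p) (hL : x + L * p ≤ (b 0).toNat) (hL' : (b 0).toNat < x + L * p + p)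
include hx hL hL'

omit hL hL' in
/-- The level of the `k`-th point is `k`. -/
theorem level_div {k : ℕ} : (x + k * p) / p = k := by
  rw [Nat.add_mul_div_right _ _ hp.out.pos, Nat.div_eq_of_lt hx, zero_add]

/-- **The cofactor at the `i`-th point is the type product** (no odd centre in the class). -/
theorem classCofactor_level₀ (e : ℕ → ℤ) (he : ∀ k ≤ L, netExp b (x + k * p) = e k)
    (hc0 : ¬ (¬ (2 : ℤ) ∣ b 0 ∧ CentreIn b p x)) {i : ℕ} (hi : i ≤ L) :
    classCofactor b p (x + i * p) = ∏ j ∈ (range (L + 1)).erase i, binomSeries ((i : ℚ) - j) (e j) := by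
  have hq := level_mem b hx hL hL' hi
  have hp0 : (p : ℚ) ≠ 0 := Nat.cast_ne_zero.2 hp.out.ne_zero
  unfold classCofactor
  rw [if_neg (fun h => hc0 ⟨h.1, (centreIn_iff_of_mem hq).1 h.2⟩), mul_one, classSet_eq_of_mem hq, classSet_level b hx hL hL',
    ← image_erase (level_injective hp.out.pos x), prod_image (fun a _ c _ h => level_injective hp.out.pos x h)]
  refine prod_congr rfl fun j hj => ?_
  have hjL : j ≤ L := by have := mem_range.1 (mem_of_mem_erase hj); omega
  rw [he j hjL]
  congr 1
  rw [div_eq_iff hp0]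
  push_cast
  ring

/-- **`ρ_{x+ip,σ} = ρ^T_{i,σ}`** (no odd centre in the class). -/
theorem classRho_level₀ (e : ℕ → ℤ) (he : ∀ k ≤ L, netExp b (x + k * p) = e k)
    (hc0 : ¬ (¬ (2 : ℤ) ∣ b 0 ∧ CentreIn b p x)) {i : ℕ} (hi : i ≤ L) (σ : ℕ) :
    classRho b p (x + i * p) σ = typeRho L e i σ := by
  unfold classRho typeRho
  rw [classCofactor_level₀ b hx hL hL' e he hc0 hi, he i hi]

/-- **`E_x = E(T)`** (no odd centre in the class). -/
theorem classExp_level₀ (e : ℕ → ℤ) (he : ∀ k ≤ L, netExp b (x + k * p) = e k)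
    (hc0 : ¬ (¬ (2 : ℤ) ∣ b 0 ∧ CentreIn b p x)) : classExp b p x = typeExp L e := by
  unfold classExp typeExp
  rw [if_neg hc0, add_zero, classSet_level b hx hL hL', sum_image (fun a _ c _ h => level_injective hp.out.pos x h)]
  exact sum_congr rfl fun k hk => he k (by have := mem_range.1 hk; omega)

/-- **`ŵ_x = ŵ(T)`** (no odd centre in the class). -/
theorem wHat_level₀ (e : ℕ → ℤ) (he : ∀ k ≤ L, netExp b (x + k * p) = e k)
    (hc0 : ¬ (¬ (2 : ℤ) ∣ b 0 ∧ CentreIn b p x)) : wHat b p x = typeW L e := by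
  have hP : (classSet b p x).filter (fun q => netExp b q < 0) =
      ((range (L + 1)).filter fun k => e k < 0).image fun k => x + k * p := classPoles_level b hx hL hL' e he
  unfold wHat typeW classPoles
  rw [hP, sum_image (fun a _ c _ h => level_injective hp.out.pos x h)]
  refine sum_congr rfl fun k hk => ?_
  have hkL : k ≤ L := by have := mem_range.1 (mem_filter.1 hk).1; omega
  rw [he k hkL, classRho_level₀ b hx hL hL' e he hc0 hkL]

/-- **`v̂_x = v̂(T)`** (no odd centre in the class). -/
theorem vHat_level₀ (e : ℕ → ℤ) (he : ∀ k ≤ L, netExp b (x + k * p) = e k)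
    (hc0 : ¬ (¬ (2 : ℤ) ∣ b 0 ∧ CentreIn b p x)) : vHat b p x = typeV L e := by
  have hP : (classSet b p x).filter (fun q => netExp b q < 0) =
      ((range (L + 1)).filter fun k => e k < 0).image fun k => x + k * p := classPoles_level b hx hL hL' e he
  unfold vHat typeV classPoles
  rw [hP, sum_image (fun a _ c _ h => level_injective hp.out.pos x h)]
  refine sum_congr rfl fun k hk => ?_
  have hkL : k ≤ L := by have := mem_range.1 (mem_filter.1 hk).1; omega
  rw [he k hkL, level_div hx]
  refine sum_congr rfl fun σ _ => ?_
  rw [classRho_level₀ b hx hL hL' e he hc0 hkL]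

/-- **`ŵ₂_x = ŵ₂(T)`** (no odd centre in the class). -/
theorem wHat2_level₀ (e : ℕ → ℤ) (he : ∀ k ≤ L, netExp b (x + k * p) = e k)
    (hc0 : ¬ (¬ (2 : ℤ) ∣ b 0 ∧ CentreIn b p x)) : wHat2 b p x = typeW2 L e := by
  have hP : (classSet b p x).filter (fun q => netExp b q < 0) =
      ((range (L + 1)).filter fun k => e k < 0).image fun k => x + k * p := classPoles_level b hx hL hL' e he
  unfold wHat2 typeW2 classPoles
  rw [hP, sum_image (fun a _ c _ h => level_injective hp.out.pos x h)]
  refine sum_congr rfl fun k hk => ?_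
  have hkL : k ≤ L := by have := mem_range.1 (mem_filter.1 hk).1; omega
  rw [he k hkL, level_div hx, classRho_level₀ b hx hL hL' e he hc0 hkL, classRho_level₀ b hx hL hL' e he hc0 hkL]

/-- **`v̂₂_x = v̂₂(T)`** (no odd centre in the class). -/
theorem vHat2_level₀ (e : ℕ → ℤ) (he : ∀ k ≤ L, netExp b (x + k * p) = e k)
    (hc0 : ¬ (¬ (2 : ℤ) ∣ b 0 ∧ CentreIn b p x)) : vHat2 b p x = typeV2 L e := by
  have hP : (classSet b p x).filter (fun q => netExp b q < 0) =
      ((range (L + 1)).filter fun k => e k < 0).image fun k => x + k * p := classPoles_level b hx hL hL' e he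
  unfold vHat2 typeV2 classPoles
  rw [hP, sum_image (fun a _ c _ h => level_injective hp.out.pos x h)]
  refine sum_congr rfl fun k hk => ?_
  have hkL : k ≤ L := by have := mem_range.1 (mem_filter.1 hk).1; omega
  rw [he k hkL, level_div hx]
  refine sum_congr rfl fun σ _ => ?_
  rw [classRho_level₀ b hx hL hL' e he hc0 hkL, classRho_level₀ b hx hL hL' e he hc0 hkL]

omit hp hx in
/-- **The top level of a level class is `L`.** -/
theorem topLevel_level : topLevel b p x = L := by
  unfold topLevel
  exact Nat.div_eq_of_lt_le (by omega) (by rw [Nat.succ_mul]; omega)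

/-- **`τ_W` of a level class** (no odd centre in the class). -/
theorem tauW_level₀ (e : ℕ → ℤ) (he : ∀ k ≤ L, netExp b (x + k * p) = e k)
    (hc0 : ¬ (¬ (2 : ℤ) ∣ b 0 ∧ CentreIn b p x)) : tauW b p x = typeTauW L e := by
  unfold tauW typeTauW
  rw [wHat2_level₀ b hx hL hL' e he hc0, wHat_level₀ b hx hL hL' e he hc0, topLevel_level b hL hL']

/-- **`τ_V` of a level class** (no odd centre in the class). -/
theorem tauV_level₀ (e : ℕ → ℤ) (he : ∀ k ≤ L, netExp b (x + k * p) = e k)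
    (hc0 : ¬ (¬ (2 : ℤ) ∣ b 0 ∧ CentreIn b p x)) : tauV b p x = typeTauV L e := by
  unfold tauV typeTauV
  rw [vHat2_level₀ b hx hL hL' e he hc0, vHat_level₀ b hx hL hL' e he hc0, topLevel_level b hL hL']

omit hp hx in
/-- **The type list of a level class is `[e₀, …, e_L]`** with `e_k = netExp(x + kp)`. -/
theorem classTypeList_level : classTypeList b p x = (List.range (L + 1)).map (fun k => netExp b (x + k * p)) := by
  unfold classTypeList
  rw [topLevel_level b hL hL']

end Level

/-! ## §3 From lists to exponent functions -/

omit hp in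
/-- Two level classes with the same type list have the same `L` and the same exponents. -/
theorem levelData_of_typeList {b : ℕ → ℤ} {x y L M : ℕ} (hL : x + L * p ≤ (b 0).toNat) (hL' : (b 0).toNat < x + L * p + p)
    (hM : y + M * p ≤ (b 0).toNat) (hM' : (b 0).toNat < y + M * p + p) (h : classTypeList b p y = classTypeList b p x) :
    M = L ∧ ∀ k ≤ L, netExp b (y + k * p) = netExp b (x + k * p) := by
  rw [classTypeList_level b hL hL', classTypeList_level b hM hM'] at h
  obtain ⟨hML, hk⟩ := levelData_of_map_eq h
  subst hML
  exact ⟨rfl, hk⟩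

omit hp in
/-- A palindromic type list: `e_{L−k} = e_k`. -/
theorem pal_of_reverse {b : ℕ → ℤ} {x L : ℕ} (hL : x + L * p ≤ (b 0).toNat) (hL' : (b 0).toNat < x + L * p + p)
    (h : (classTypeList b p x).reverse = classTypeList b p x) :
    ∀ k ≤ L, netExp b (x + (L - k) * p) = netExp b (x + k * p) := by
  rw [classTypeList_level b hL hL', map_range_reverse] at h
  exact (levelData_of_map_eq h).2

/-- The RAISE of an exponent function at the level `k`. -/
def raiseAt (e : ℕ → ℤ) (k : ℕ) : ℕ → ℤ := fun i => if i = k then e i + 1 else e i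

/-- The exponent function of `1 :: T`: a new zero at level `0`, the old levels moved up by one. -/
def consOne (e : ℕ → ℤ) : ℕ → ℤ := fun i => if i = 0 then 1 else e (i - 1)

/-- The exponent function of `T ++ [1]`: a new zero at level `L + 1`. -/
def snocOne (e : ℕ → ℤ) (L : ℕ) : ℕ → ℤ := fun i => if i = L + 1 then 1 else e i

omit hp in
/-- `T.mapIdx (raise at k)` as a level list. -/
theorem mapIdx_range_map (e : ℕ → ℤ) (L k : ℕ) :
    ((List.range (L + 1)).map e).mapIdx (fun i a => if i = k then a + 1 else a) = (List.range (L + 1)).map (raiseAt e k) := by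
  apply List.ext_getElem
  · simp
  · intro i h1 h2
    simp [List.getElem_mapIdx, raiseAt]

omit hp in
/-- `1 :: T` as a level list. -/
theorem cons_range_map (e : ℕ → ℤ) (L : ℕ) :
    (1 : ℤ) :: (List.range (L + 1)).map e = (List.range (L + 1 + 1)).map (consOne e) := by
  conv_rhs => rw [List.range_succ_eq_map, List.map_cons, List.map_map]
  have h1 : consOne e 0 = 1 := by simp [consOne]
  have h2 : (List.range (L + 1)).map (consOne e ∘ Nat.succ) = (List.range (L + 1)).map e :=
    List.map_congr_left fun i _ => by simp [consOne]
  rw [h1, h2]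

omit hp in
/-- `T ++ [1]` as a level list. -/
theorem snoc_range_map (e : ℕ → ℤ) (L : ℕ) :
    (List.range (L + 1)).map e ++ [1] = (List.range (L + 1 + 1)).map (snocOne e L) := by
  conv_rhs => rw [List.range_succ, List.map_append, List.map_singleton]
  congr 1
  · refine List.map_congr_left fun i hi => ?_
    have := List.mem_range.1 hi
    simp [snocOne, show i ≠ L + 1 by omega]
  · simp [snocOne]

omit hp in
/-- **The shape of a raised class.**  If `isRaise T S` holds for the level lists `T = [e₀,…,e_L]` and `S = [f₀,…,f_M]`, then `S` is
`[raiseAt e k]` for some `k ≤ L` (with `M = L`), or `1 :: T`, or `T ++ [1]` (with `M = L + 1`). -/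
theorem isRaise_level {e f : ℕ → ℤ} {L M : ℕ}
    (h : isRaise ((List.range (L + 1)).map e) ((List.range (M + 1)).map f) = true) :
    (∃ k ≤ L, M = L ∧ ∀ i ≤ L, f i = raiseAt e k i) ∨
      (M = L + 1 ∧ ∀ i ≤ L + 1, f i = consOne e i) ∨ (M = L + 1 ∧ ∀ i ≤ L + 1, f i = snocOne e L i) := by
  unfold isRaise at h
  simp only [Bool.or_eq_true, List.any_eq_true, beq_iff_eq, List.mem_range, List.length_map, List.length_range] at h
  rcases h with (⟨k, hk, hS⟩ | hS) | hS
  · rw [mapIdx_range_map] at hS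
    obtain ⟨hML, hi⟩ := levelData_of_map_eq hS
    exact Or.inl ⟨k, by omega, hML, fun i hi' => hi i (by omega)⟩
  · rw [cons_range_map] at hS
    obtain ⟨hML, hi⟩ := levelData_of_map_eq hS
    exact Or.inr (Or.inl ⟨hML, fun i hi' => hi i (by omega)⟩)
  · rw [snoc_range_map] at hS
    obtain ⟨hML, hi⟩ := levelData_of_map_eq hS
    exact Or.inr (Or.inr ⟨hML, fun i hi' => hi i (by omega)⟩)

end Summit.KontsevichZagierPeriods.Zeta5Search.SecondOrder

end
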